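import Summits.BirchSwinnertonDyer.BirchSwinnertonDyer.Theorems.SignedLowerHalvesKobayashiMainConjectureSmallImageLambdaTransferCM
import Summits.BirchSwinnertonDyer.BirchSwinnertonDyer.Theorems.SignedLowerHalvesKobayashiLowerHalfLargeImageCongruencePlaces
import Summits.BirchSwinnertonDyer.BirchSwinnertonDyer.Theorems.SignedLowerHalvesKobayashiLowerHalfLargeImageCongruencePlacesGood
import Summits.BirchSwinnertonDyer.BirchSwinnertonDyer.Theorems.SignedLowerHalvesKobayashiMainConjectureSmallImageCMTransferMuRecords02
import Summits.BirchSwinnertonDyer.BirchSwinnertonDyer.Theorems.SignedLowerHalvesKobayashiMainConjectureSmallImageCMTransferRecordsA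
import Summits.BirchSwinnertonDyer.BirchSwinnertonDyer.Theorems.SignedLowerHalvesKobayashiMainConjectureSmallImageLambdaTransferCM25RecordsE
import Literature.NumberTheory.EllipticCurves.Fisher2012.HesseFamilyFiveClosedForms
import HarnessLib

/-!
# Route `SignedLowerHalves`, crux `KobayashiMainConjectureSmallImage` (item stmt-BirchSwinnertonDyer-19002):
# small-image congruence road («L4-λ») — RECORDS «L4LAM-r2» part F: 207616g1 @ 5, DIRECT-family twin of part E (cell `bsd-ssimc`, seat `bsd-ssimc-k3-c4` gen 9; planner D28-7 (c) «L4LAM-r2-E», variant E′;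
# a `--supports stmt-BirchSwinnertonDyer-19002 --as helper` file; closes nothing about the crux)

PARTITION (cell bsd-ssimc): X7 (A7) × the pair `207616g1 @ 5` — per-pair records (Kobayashi's signed main conjecture for the listed signs and `BSD(E,5)`, from
PUBLISHED facts + displayed certificates); the crux `KobayashiMainConjectureSmallImage` stays OPEN; 0 census moves are booked here (desk
keys are the planner's to file); BSD is not proved by any of this. THEOREMS ONLY.

## Provenance (finding «CM-25» of the seat's MEMO-8)

These pairs were booked «no CM elliptic-curve partner» by the seat's gen-0 probe (`cm_congruence_probe.tsv`), which at `p = 3` searched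
only the `j = 1728` family; the quadratic field of the normaliser character is in fact a class-number-one field with `p` inert, and the CM
curve of that field (or a quadratic twist) IS `p`-congruent to `E` — here PROVED in the kernel by a Fisher Hesse-pencil identity (`norm_num`;
certificates found by g5's exact `cert/hesse3_find.py` at `p = 3`, by g0's `hesse.gp` (PARI, kit j268836) at `p = 5`). The records then run
verbatim on g6's road (`…LambdaTransferCM.lean` p473173; template `…LambdaTransferCMRecords01.lean` p474509):
`SmallImageCongruenceRoad.kobayashiMainConjecture_{neg_one,one}_of_cmPartner_of_mazurTate` — partner MC = Pollack–Rubin 2004 BY NAME (`hPR`;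
`p` inert in the CM field, checked per pair), Kim 2009 μ- and λ-transfer BY NAME (`h09`, `hKim`), Kobayashi Thm. 1.2 / 4.1-rational (`h12`,
`h41`), period units (`h5`, `h3`), modularity (`hmod`), Pollack (`hPollack`), Fisher 2012 Thm. 13.2 (`hF`, the DIRECT n = 5 family — the binder of parts B/C); per pair the DISPLAYED certificate rows (two engines
agreeing: B = b2b msengine `MSENGINE_SHA256SUMS`, T = iw-2 `engT.py` d8b96ce8, byte-identical re-uses, kit j268836; E-side rows also b2b
`b2b-bsdres-iw-2/tables/engT_layers.tsv` CERTIFIED+AGREE where marked) as `(hΘ, hΘ0, hμ, hlam)` quadruples, and the KERNEL-DECIDED δ-bookkeeping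
(`places_<tag>`, toolkit `…LargeImageCongruencePlaces(.Good).lean` p467415). NO `Surj`, NO `BSD(E,p)` input, NO preprint, NO Mazur–Tate
congruence `hMT`.

This part: the SAME pair and road as part E (p505593), with the congruence step moved to the DIRECT family so that the only Hesse binder is `hF : thm132_fiveCongruent_hessePencil` (Fisher 2012 Thm. 13.2) — the one parts B/C carry (priced at referee A's desk R461) — instead of part E's `hF'` (Fisher 2013 Thm. 5.8). The price is a different partner MODEL: A′ = `[0,1,0,-13,-21]` (c₄, c₆, Δ) = (640, 14336, 2¹⁵) = the quadratic twist by −2 of `[0,1,0,-3,1]`, which for this CM-by-ℤ[√−2] curve is its 2-ISOGENOUS curve (same conductor 256, same j = 8000, same newform); `207616g1 ≅` the member (16:1) of X_{A′}(5), u = 63700992 (kit j270060 Part 4; identities `𝔠₄(16,1) = u⁴c₄(E)`, `𝔠₆(16,1) = u⁶c₆(E)` by `norm_num`). Global minimality of A′ (an instance binder, as everywhere): no integral model has (c₄, c₆) = (40, 224) (c₄ ≡ 8 mod 16 is impossible), so the 2¹⁵-model cannot be descaled. Partner MT rows are NEWFORM data (`mazurTateElement f₀' 5 n` with `hf₀'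 : IsNewformOf A′ f₀'`): the displayed values are those certified for the isogenous model in kit j268836 (see the record's docstring). BOTH signs + the `BSDp W 5` door, exactly as part E. E-side kernel data (`card_lam25_207616g1_5`) IMPORTED from part E. Nothing here supersedes part E; the planner / desk choose which binder set to key.

References: [Kobayashi2003] Conj. (p. 2), Thm. 1.2, 4.1; [BDKim2009] Cor. 2.13, 2.5, Prop. 2.6; [PollackRubin2004] Thm. (p. 448);
[Pollack2003] Def. 6.15, Prop. 6.9/6.10/6.18; [Fisher2012Hessian] Thm. 13.2, §13; [GreenbergVatsal2000] Prop. (2.4); [BDKim2013] Cor. 3.15;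
[Cremona2006] Table 1; [SilvermanAEC2009] V §2, VII.5, App. C §11. Memo: `HOME/k3c4-MEMO-8.md` + addendum E (`k3c4-MEMO-8-addE.md`, §2′).
-/

set_option autoImplicit false
set_option linter.dupNamespace false
noncomputable section

open scoped Classical MatrixGroups ModularForm BigOperators

open CongruenceSubgroup WeierstrassCurve NumberField IsDedekindDomain Rat.HeightOneSpectrum
  Literature.NumberTheory.EllipticCurves
  Literature.NumberTheory.EllipticCurves.ModularForms
  Literature.NumberTheory.EllipticCurves.Rank1Residual
  Literature.NumberTheory.EllipticCurves.Rank1Residual.Typed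
  Literature.NumberTheory.EllipticCurves.Kobayashi2003 ZpExtension
  Literature.NumberTheory.EllipticCurves.GreenbergVatsal2000
  Literature.NumberTheory.EllipticCurves.BDKim2009
  Literature.NumberTheory.EllipticCurves.Fisher2012
  Literature.NumberTheory.EllipticCurves.Rank1Residual.X11RankOneCertificates
  Literature.NumberTheory.GaloisRepresentations
  Summit.BirchSwinnertonDyer.Rank1Residual.X1.MuLambda
  Summit.BirchSwinnertonDyer.Rank1Residual.Supersingular
  Summit.BirchSwinnertonDyer.Rank1Residual.X2.LocalDeltaCalculus
  Summit.BirchSwinnertonDyer.BirchSwinnertonDyer.Rank1Residual.IntModel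
  Summit.BirchSwinnertonDyer.BirchSwinnertonDyer.Rank1Residual.X11RankOne
  Summit.BirchSwinnertonDyer.Rank1Residual.X11b
  Summit.BirchSwinnertonDyer.Rank1Residual.X9
  Summit.BirchSwinnertonDyer.Rank1Residual.X1
  Summit.BirchSwinnertonDyer.BirchSwinnertonDyer.Theorems.CongruenceRoad

namespace Summit.BirchSwinnertonDyer.BirchSwinnertonDyer.Theorems.SmallImageCongruenceRoad



/-! ### §1 Kernel data of the partner A′ and of the pair -/

/-- `#{Ẽ(𝔽_5)} = 6` for the CM partner A′ = `[0, 1, 0, -13, -21]` (`a_5 = 0`; kernel count). [cite: SilvermanAEC2009, V §2 (a_p = p + 1 − #Ẽ(𝔽_p))] -/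
theorem card_lam25_A256tw_5 :
    Nat.card (((⟨0, 1, 0, -13, -21⟩ : WeierstrassCurve ℤ).map
      (Int.castRingHom (ZMod 5))).toAffine.Point) = 6 := by
  rw [@WeierstrassCurve.natCard_point_eq_one_add_card (ZMod 5) (@ZMod.instField 5 ⟨by norm_num⟩) _ _ _
    (by decide +kernel), @card_sol_eq_sum_euler (ZMod 5) (@ZMod.instField 5 ⟨by norm_num⟩) _ _
    (by rw [ZMod.ringChar_zmod_n]; decide), ZMod.card]
  decide +kernel
/-- The CM partner A′ = `[0, 1, 0, -13, -21]` has CM (`j = 8000 ∈` the thirteen rational CM values; kernel). [cite: SilvermanAEC2009, App. C §11] -/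
theorem hasCM_lam25_A256tw {A : WeierstrassCurve ℚ} [A.IsElliptic] [A.IsGloballyMinimal]
    (hIA : integralModelInt A = ⟨0, 1, 0, -13, -21⟩) : A.HasCM :=
  (hasCM_iff_j_mem_holds A).mpr (by rw [j_eq_of_intModel 0 1 0 (-13) (-21) hIA]; decide +kernel)

/-- `#(𝔽_811)`-point count `850` of `[0, 1, 0, -13, -21]` (the CM partner A of the pair `207616g1 @ 5`; fast count, kernel). [cite: SilvermanAEC2009, V §2] -/
theorem countPoints_207616g1_5_dir_A_811 : countPoints [0, 1, 0, -13, -21] 811 = (850 : ℕ) :=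
  countPoints_eq_of_fast (by decide +kernel)

/-- **The δ-bookkeeping of `(207616g1, A = cmm8_tw3_p5 ⊗ χ₋₂ (2-isogenous partner))` at `5`, KERNEL-DECIDED**: with `Σ₀` the places over `{2, 811}` (away from
`5`, containing every bad place of both curves), `Σ_{Σ₀} δ_E = 1` and `Σ_{Σ₀} δ_A = 2` (ℓ = 2: E additive; ℓ = 2: A additive; ℓ = 811: E split; ℓ = 811: A good_dvd).
[cite: GreenbergVatsal2000, §2 Prop. (2.4) (p. 22)] [cite: SilvermanAEC2009, VII.5 Prop. 5.1] -/
theorem places_207616g1_5_dir (W A : WeierstrassCurve ℚ) [W.IsElliptic] [W.IsGloballyMinimal]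
    [A.IsElliptic] [A.IsGloballyMinimal]
    (hW : W = ⟨0, 0, 0, -158470, 31707704⟩) (hA : A = ⟨0, 1, 0, -13, -21⟩) :
    ∃ S₀ : Finset (HeightOneSpectrum (𝓞 ℚ)), (∀ v ∈ S₀, ((5 : ℕ) : 𝓞 ℚ) ∉ v.asIdeal) ∧
      (∀ v : HeightOneSpectrum (𝓞 ℚ), ¬ W.HasGoodReductionAt v → v ∈ S₀) ∧
      (∀ v : HeightOneSpectrum (𝓞 ℚ), ¬ A.HasGoodReductionAt v → v ∈ S₀) ∧
      ∑ v ∈ S₀, delta W 5 v = 1 ∧ ∑ v ∈ S₀, delta A 5 v = 2 := by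
  have hI : integralModelInt W = ⟨0, 0, 0, -158470, 31707704⟩ :=
    integralModelInt_eq_of_map_eq _ (by rw [hW]; ext <;> simp [WeierstrassCurve.map])
  have hI' : integralModelInt A = ⟨0, 1, 0, -13, -21⟩ :=
    integralModelInt_eq_of_map_eq _ (by rw [hA]; ext <;> simp [WeierstrassCurve.map])
  set v2 : HeightOneSpectrum (𝓞 ℚ) := (primesEquiv (R := 𝓞 ℚ)).symm ⟨2, Nat.prime_two⟩ with hv2
  set v811 : HeightOneSpectrum (𝓞 ℚ) := (primesEquiv (R := 𝓞 ℚ)).symm ⟨811, by norm_num⟩ with hv811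
  have d2 : delta W 5 v2 = 0 :=
    delta_eq_zero_of_dvd_of_dvd hI 5 v2 (by rw [hv2, natGenerator_symm]; decide)
      (by rw [hv2, natGenerator_symm]; decide)
  have d811 : delta W 5 v811 = 1 := by
    rw [delta_eq_of_split hI 5 v811 811 (by norm_num) (by rw [hv811, natGenerator_symm]) (by decide) (by decide)
      ⟨98, by decide +kernel⟩, sFactor_eq_of_eq_pow_mul (k := 0) (m := 86519382768) (by norm_num) (by norm_num)]
    decide
  have e2 : delta A 5 v2 = 0 :=
    delta_eq_zero_of_dvd_of_dvd hI' 5 v2 (by rw [hv2, natGenerator_symm]; decide)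
      (by rw [hv2, natGenerator_symm]; decide)
  have e811 : delta A 5 v811 = 2 := by
    rw [delta_eq_of_good_of_dvd_count hI' 5 v811 811 (by norm_num) (by rw [hv811, natGenerator_symm]) (by norm_num)
      (by norm_num) rfl (by decide) countPoints_207616g1_5_dir_A_811 (by decide),
      sFactor_eq_of_eq_pow_mul (k := 0) (m := 86519382768) (by norm_num) (by norm_num)]
    decide
  have n1 : v2 ∉ ({v811} : Finset (HeightOneSpectrum (𝓞 ℚ))) := by
    simp only [Finset.mem_singleton, hv2, hv811]
    exact symm_ne_symm _ _ (by norm_num)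
  refine ⟨{v2, v811}, ?_, ?_, ?_, ?_, ?_⟩
  · intro v hv
    simp only [Finset.mem_insert, Finset.mem_singleton] at hv
    rcases hv with rfl | rfl
    · exact natCast_not_mem_symm (by norm_num) _ (by norm_num)
    · exact natCast_not_mem_symm (by norm_num) _ (by norm_num)
  · -- `Σ₀ ⊇` bad places of `E`: `Δ(E) = -(2 ^ 9 * 811 ^ 5)`
    intro v hv
    by_contra hvS
    apply hv
    apply hasGoodReductionAt_of_not_dvd hI
    intro hdvd
    have hΔ : (⟨0, 0, 0, -158470, 31707704⟩ : WeierstrassCurve ℤ).Δ = -(2 ^ 9 * 811 ^ 5) := by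
      decide
    rw [hΔ, dvd_neg] at hdvd
    have hpr := prime_natGenerator v
    have h' : natGenerator v ∣ 2 ^ 9 * 811 ^ 5 := by exact_mod_cast hdvd
    have key : natGenerator v = 2 ∨ natGenerator v = 811 := by
      rcases (Nat.Prime.dvd_mul hpr).mp h' with h | h
      · exact Or.inl ((Nat.prime_dvd_prime_iff_eq hpr Nat.prime_two).mp (hpr.dvd_of_dvd_pow h))
      · exact Or.inr ((Nat.prime_dvd_prime_iff_eq hpr (by norm_num)).mp (hpr.dvd_of_dvd_pow h))
    apply hvS
    simp only [Finset.mem_insert, Finset.mem_singleton]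
    rcases key with h | h
    · exact Or.inl (eq_symm_of_natGenerator_eq Nat.prime_two h)
    · exact Or.inr (eq_symm_of_natGenerator_eq (by norm_num) h)
  · -- `Σ₀ ⊇` bad places of `A`: `Δ(A) = 2 ^ 15`
    intro v hv
    by_contra hvS
    apply hv
    apply hasGoodReductionAt_of_not_dvd hI'
    intro hdvd
    have hΔ : (⟨0, 1, 0, -13, -21⟩ : WeierstrassCurve ℤ).Δ = 2 ^ 15 := by
      decide
    rw [hΔ] at hdvd
    have hpr := prime_natGenerator v
    have h' : natGenerator v ∣ 2 ^ 15 := by exact_mod_cast hdvd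
    have key : natGenerator v = 2 := by
      exact (Nat.prime_dvd_prime_iff_eq hpr Nat.prime_two).mp (hpr.dvd_of_dvd_pow h')
    apply hvS
    simp only [Finset.mem_insert, Finset.mem_singleton]
    exact Or.inl (eq_symm_of_natGenerator_eq Nat.prime_two key)
  · norm_num [Finset.sum_insert n1, Finset.sum_singleton, d2, d811]
  · norm_num [Finset.sum_insert n1, Finset.sum_singleton, e2, e811]

/-! ### §2 The records (direct family, partner A′) -/

/-- **`lam4_207616g1_5_dir` — Kobayashi's main conjecture for `(207616g1, 5, ε)`, EITHER sign, AT THE PAIR by the small-image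
congruence road with the CM partner `A = cmm8_tw3_p5 ⊗ χ₋₂ (2-isogenous partner)` = `[0, 1, 0, -13, -21]` ([0,1,0,-13,-21] (conductor 256, CM by ℤ[√−2], j = 8000: the quadratic twist by −2 = the 2-ISOGENOUS curve of part B/E's partner [0,1,0,-3,1]; `5` inert in ℚ(√−2); r_an = 1)) — NO preprint, NO `Surj`, NO `BSD(E,5)` input, NO Mazur–Tate
congruence `hMT`.** Desk cell (referee A's live state `scratchA_A_state_after_addord3_fold.pkl` sha16 1edf686acdce8117): `residue; [(5,'X7')]` (OPEN). Certificates DISPLAYED as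
hypotheses (kit j268836, engines byte-identical re-uses: B = b2b msengine `MSENGINE_SHA256SUMS`, T = iw-2 `engT.py` d8b96ce8, A = PARI `ellpadiclambdamu` via
`engineA.py` a8b8e893; E-side rows also b2b `tables/engT_layers.tsv` where marked): ε = -1: E row θ_1 (λ = deg ω_1^+ + 2), A row θ_1 (λ = deg + 1); ε = 1: E row θ_2 (λ = deg ω_2^− + 2), A row θ_2 (λ = deg + 1). E rows = b2b `b2b-bsdres-iw-2/tables/engT_layers.tsv` 207616g1@5 (as in part E): layer 1 (odd, ε = −1) λ(θ₁) = 2 = deg ω₁⁺ + 2, engine T CERTIFIED (V = 2), engine B (0, 2) AGREE; layer 2 (even, ε = +1) λ(θ₂) = 6 = deg ω₂⁻ + 2, engine T CERTIFIED (V = 6), engine B (0, 6) AGREE (quoted, not re-run); partner rows: θ_n of the NEWFORM of conductor 256 attached to A′ — the same newform as part B/E's partner `[0,1,0,-3,1]` (the two curves are 2-isogenous, hence share their L-function and newform; the Mazur–Tate element is a newform-level object in the tree, `mazurTateElement f₀' 5 n`) — kit j268836 key `cmm8_tw3_p5`: θ₁: λ = 1 = deg ω₁⁺ + 1 — engine T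 CERTIFIED V = 1 (exact `msfromell` match), engine B (μ, λ) = (0, 1), engine A `ellpadiclambdamu` = [[1, 1], [0, 0]]; θ₂: λ = 5 = deg ω₂⁻ + 1 — engine T CERTIFIED V = 5, engine B (0, 5); the engines ran on `[0,1,0,-3,1]`, whose Néron period differs from A′'s by a power of 2 (a 5-adic unit), so (μ, λ) are unchanged. The `5`-congruence is KERNEL-CHECKED
(`E` ≅ the member (16 : 1) of Fisher's DIRECT pencil X_{A′}(5) of the minimal model `[0,1,0,-13,-21]` (c₄, c₆, Δ) = (640, 14336, 2¹⁵), u = 63700992, `fiveCongruent_of_hesseCertificate` under the named fact `hF` (Fisher 2012 Thm. 13.2 — the binder of parts B/C); found by the seat's exact ℙ¹(ℚ) search kit j270060 (Part 4, curve 2) and re-verified in exact arithmetic by an independent re-implementation of Fisher's Hessian/Jacobian construction (which also reproduces part B's certificate)); the δ-bookkeeping `l_E + 1 = l_A + 2` is `places_207616g1_5_dir` (kernel); `a_5 = 0` for both curves and the CM of `A` are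
decided in the kernel. Published inputs BY NAME (`h12 h41 h5 h3 h09 hKim hPR hmod hPollack hF`). PER PAIR; crux 4 stays OPEN; nothing booked;
BSD is not proved by any of this.
[cite: Kobayashi2003, Conjecture (p. 2), Thm. 1.2 and Thm. 4.1] [cite: BDKim2009, Cor. 2.13, Cor. 2.5 and Prop. 2.6 (pp. 185–187)]
[cite: PollackRubin2004, Theorem (p. 448) = Thm. 7.3] [cite: Pollack2003, Def. 6.15, Prop. 6.9, 6.10 and 6.18]
[cite: Fisher2012Hessian, Thm. 13.2 and §13] [cite: GreenbergVatsal2000, §2 Prop. (2.4)] [cite: Cremona2006, Table 1 (Cremona label 207616g1)] -/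
theorem lam4_kobayashiMainConjecture_207616g1_5_dir
    (h12 : Kobayashi2003.thm12_signedSelmerDual_finite_torsion)
    (h41 : Kobayashi2003.thm41_signedCharIdeal_divisibility)
    (h5 : realPeriodRat_eq_unit_mul_plusPeriod) (h3 : realPeriodRat_eq_unit_mul_plusPeriod_three)
    (h09 : cor213_signedMu_eq_zero_iff_of_torsionIso)
    (hKim : BDKim2009.cor213_signedLambda_add_sum_delta_eq_of_torsionIso)
    (hPR : PollackRubin2004.mainTheorem_signedCharIdeal_eq_of_cm)
    (hmod : nonempty_modularParametrizationData)
    (hF : thm132_fiveCongruent_hessePencil)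
    (W A : WeierstrassCurve ℚ) [W.IsElliptic] [W.IsGloballyMinimal] [A.IsElliptic] [A.IsGloballyMinimal]
    [Fact (Nat.Prime 5)] (hW : W = ⟨0, 0, 0, -158470, 31707704⟩) (hA : A = ⟨0, 1, 0, -13, -21⟩)
    (hPollack : ∀ {N : ℕ} [NeZero N] {f : CuspForm (Gamma0 N) 2},
      pollack_exists_plusMinusPAdicLFunction (W := A) (f := f) (p := 5))
    [NeZero (W.conductorNorm ℤ)] {f₀ : CuspForm (Gamma0 (W.conductorNorm ℤ)) 2} (hf₀ : IsNewformOf W f₀)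
    [NeZero (A.conductorNorm ℤ)] {f₀' : CuspForm (Gamma0 (A.conductorNorm ℤ)) 2} (hf₀' : IsNewformOf A f₀')
    (ε : ℤˣ) {Θ Θ' : IwasawaAlgebra 5} (hΘ0 : Θ ≠ 0) (hμ : mu Θ = 0) (hΘ'0 : Θ' ≠ 0) (hμ' : mu Θ' = 0)
    (hrow : (ε = -1 ∧
        iwasawaToPowerSeries 5 Θ = ((mazurTateElement f₀ 5 1).map (algebraMap ℚ ℚ_[5]) : PowerSeries ℚ_[5]) ∧
        lam Θ = (cyclotomicOmegaPlus 5 1).natDegree + 2 ∧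
        iwasawaToPowerSeries 5 Θ' = ((mazurTateElement f₀' 5 1).map (algebraMap ℚ ℚ_[5]) : PowerSeries ℚ_[5]) ∧
        lam Θ' = (cyclotomicOmegaPlus 5 1).natDegree + 1) ∨
      (ε = 1 ∧
        iwasawaToPowerSeries 5 Θ = ((mazurTateElement f₀ 5 2).map (algebraMap ℚ ℚ_[5]) : PowerSeries ℚ_[5]) ∧
        lam Θ = (cyclotomicOmegaMinus 5 2).natDegree + 2 ∧
        iwasawaToPowerSeries 5 Θ' = ((mazurTateElement f₀' 5 2).map (algebraMap ℚ ℚ_[5]) : PowerSeries ℚ_[5]) ∧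
        lam Θ' = (cyclotomicOmegaMinus 5 2).natDegree + 1)) :
    KobayashiMainConjecture W 5 ε := by
  have hI : integralModelInt W = ⟨0, 0, 0, -158470, 31707704⟩ :=
    integralModelInt_eq_of_map_eq _ (by rw [hW]; ext <;> simp [WeierstrassCurve.map])
  have hI' : integralModelInt A = ⟨0, 1, 0, -13, -21⟩ :=
    integralModelInt_eq_of_map_eq _ (by rw [hA]; ext <;> simp [WeierstrassCurve.map])
  have hp2 : (5 : ℕ) ≠ 2 := by decide
  have hSS : GoodSS W 5 := goodSS_of_intModel 5 hI (by decide) card_lam25_207616g1_5 (by norm_num)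
  have hap : W.frobeniusTrace 5 = 0 := by rw [frobeniusTrace_eq hI card_lam25_207616g1_5]; norm_num
  have hSS' : GoodSS A 5 := goodSS_of_intModel 5 hI' (by decide) card_lam25_A256tw_5 (by norm_num)
  have hap' : A.frobeniusTrace 5 = 0 := by rw [frobeniusTrace_eq hI' card_lam25_A256tw_5]; norm_num
  have hcm' : A.HasCM := hasCM_lam25_A256tw hI'
  have hc4 : W.c₄ = (7606560 : ℚ) := by
    subst hW; norm_num [WeierstrassCurve.c₄, WeierstrassCurve.b₂, WeierstrassCurve.b₄]
  have hc6 : W.c₆ = (-27395456256 : ℚ) := by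
    subst hW; norm_num [WeierstrassCurve.c₆, WeierstrassCurve.b₂, WeierstrassCurve.b₄, WeierstrassCurve.b₆]
  have hc4A : A.c₄ = (640 : ℚ) := by
    subst hA; norm_num [WeierstrassCurve.c₄, WeierstrassCurve.b₂, WeierstrassCurve.b₄]
  have hc6A : A.c₆ = (14336 : ℚ) := by
    subst hA; norm_num [WeierstrassCurve.c₆, WeierstrassCurve.b₂, WeierstrassCurve.b₄, WeierstrassCurve.b₆]
  -- the 5-congruence `E[5] ≃ A[5]` as a THEOREM (Fisher's pencil of `A` through `E`), kernel-checked
  have he := fiveCongruent_of_hesseCertificate hF A W (16 : ℚ) (1 : ℚ) (63700992 : ℚ)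
    (by norm_num) (by rw [hc4A, hc6A, hc4, eval_hesseC4]; norm_num)
    (by rw [hc4A, hc6A, hc6, eval_hesseC6]; norm_num)
  obtain ⟨S₀, hS₀, hS₀W, hS₀A, hsumW, hsumA⟩ := places_207616g1_5_dir W A hW hA
  rcases hrow with ⟨rfl, hΘ, hlam, hΘ', hlam'⟩ | ⟨rfl, hΘ, hlam, hΘ', hlam'⟩
  · exact kobayashiMainConjecture_neg_one_of_cmPartner_of_mazurTate h12 h41 h5 h3 h09 hKim hPR hmod hp2 hSS.1
      hap hf₀ (by decide) hΘ hΘ0 hμ hlam hPollack hcm' hSS' hap' he hf₀' (by decide) hΘ' hΘ'0 hμ' hlam' S₀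
      hS₀ hS₀W hS₀A (by rw [hsumW, hsumA])
  · exact kobayashiMainConjecture_one_of_cmPartner_of_mazurTate h12 h41 h5 h3 h09 hKim hPR hmod hp2 hSS.1
      hap hf₀ (by decide) hΘ hΘ0 hμ hlam hPollack hcm' hSS' hap' he hf₀' (by decide) hΘ' hΘ'0 hμ' hlam' S₀
      hS₀ hS₀W hS₀A (by rw [hsumW, hsumA])

/-- **Item 4's statement AT THE PAIR `207616g1 @ 5`**: `∃ ε, KobayashiMainConjecture W 5 ε`, from `lam4_kobayashiMainConjecture_207616g1_5_dir` with
the `ε = -1` rows. PER PAIR; the crux is untouched; nothing booked. [cite: Kobayashi2003, Conjecture (p. 2) and Thm. 4.1] [cite: BDKim2009, Cor. 2.13 (p. 187)]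
[cite: Cremona2006, Table 1 (Cremona label 207616g1)] -/
theorem lam4_exists_kobayashiMainConjecture_207616g1_5_dir
    (h12 : Kobayashi2003.thm12_signedSelmerDual_finite_torsion)
    (h41 : Kobayashi2003.thm41_signedCharIdeal_divisibility)
    (h5 : realPeriodRat_eq_unit_mul_plusPeriod) (h3 : realPeriodRat_eq_unit_mul_plusPeriod_three)
    (h09 : cor213_signedMu_eq_zero_iff_of_torsionIso)
    (hKim : BDKim2009.cor213_signedLambda_add_sum_delta_eq_of_torsionIso)
    (hPR : PollackRubin2004.mainTheorem_signedCharIdeal_eq_of_cm)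
    (hmod : nonempty_modularParametrizationData)
    (hF : thm132_fiveCongruent_hessePencil)
    (W A : WeierstrassCurve ℚ) [W.IsElliptic] [W.IsGloballyMinimal] [A.IsElliptic] [A.IsGloballyMinimal]
    [Fact (Nat.Prime 5)] (hW : W = ⟨0, 0, 0, -158470, 31707704⟩) (hA : A = ⟨0, 1, 0, -13, -21⟩)
    (hPollack : ∀ {N : ℕ} [NeZero N] {f : CuspForm (Gamma0 N) 2},
      pollack_exists_plusMinusPAdicLFunction (W := A) (f := f) (p := 5))
    [NeZero (W.conductorNorm ℤ)] {f₀ : CuspForm (Gamma0 (W.conductorNorm ℤ)) 2} (hf₀ : IsNewformOf W f₀)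
    [NeZero (A.conductorNorm ℤ)] {f₀' : CuspForm (Gamma0 (A.conductorNorm ℤ)) 2} (hf₀' : IsNewformOf A f₀')
    {Θ Θ' : IwasawaAlgebra 5}
    (hΘ : iwasawaToPowerSeries 5 Θ = ((mazurTateElement f₀ 5 1).map (algebraMap ℚ ℚ_[5]) : PowerSeries ℚ_[5]))
    (hΘ0 : Θ ≠ 0) (hμ : mu Θ = 0) (hlam : lam Θ = (cyclotomicOmegaPlus 5 1).natDegree + 2)
    (hΘ' : iwasawaToPowerSeries 5 Θ' = ((mazurTateElement f₀' 5 1).map (algebraMap ℚ ℚ_[5]) : PowerSeries ℚ_[5]))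
    (hΘ'0 : Θ' ≠ 0) (hμ' : mu Θ' = 0) (hlam' : lam Θ' = (cyclotomicOmegaPlus 5 1).natDegree + 1) :
    ∃ ε : ℤˣ, KobayashiMainConjecture W 5 ε :=
  ⟨-1, lam4_kobayashiMainConjecture_207616g1_5_dir h12 h41 h5 h3 h09 hKim hPR hmod hF W A hW hA hPollack hf₀ hf₀'
    (-1) hΘ0 hμ hΘ'0 hμ' (Or.inl ⟨rfl, hΘ, hlam, hΘ', hlam'⟩)⟩

/-- **`BSD(E,5)` for `207616g1`** (X7, `r_an = 0`, `5Nn`; desk cell `residue; [(5,'X7')]` (OPEN)) **through the IMAGE-FREE rank-0 road**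
`bsdp_of_kobayashiMainConjecture_of_analyticRank_eq_zero` (Kobayashi Thm. 1.2 `h12`, B. D. Kim 2013 Cor. 3.15 `hKim13`, Pollack `hPollackW`,
modularity `hmod`/`hmod'`, GZK `hGZK`) fed with `lam4_kobayashiMainConjecture_207616g1_5_dir` (`ε = -1` rows); the rank datum `hr : r_an = 0` (Cremona)
is displayed; class X7 decided in the kernel (good supersingular at `5`, additive at `2`). NO descent certificate, NO `BSDp` input, NO preprint.
PER PAIR; nothing booked; BSD is not proved by any of this.
[cite: Kobayashi2003, Thm. 1.2 and Conjecture (p. 2)] [cite: BDKim2013, Cor. 3.15 (p. 199)] [cite: BDKim2009, Cor. 2.13 (p. 187)]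
[cite: Miller2011LMS, Def. 1.1] [cite: Cremona2006, Table 1 (Cremona label 207616g1)] -/
theorem lam4_bsdp_207616g1_5_dir
    (h12 : Kobayashi2003.thm12_signedSelmerDual_finite_torsion)
    (h41 : Kobayashi2003.thm41_signedCharIdeal_divisibility)
    (h5 : realPeriodRat_eq_unit_mul_plusPeriod) (h3 : realPeriodRat_eq_unit_mul_plusPeriod_three)
    (h09 : cor213_signedMu_eq_zero_iff_of_torsionIso)
    (hKim : BDKim2009.cor213_signedLambda_add_sum_delta_eq_of_torsionIso)
    (hPR : PollackRubin2004.mainTheorem_signedCharIdeal_eq_of_cm)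
    (hmod : nonempty_modularParametrizationData)
    (hF : thm132_fiveCongruent_hessePencil) (hmod' : hasEntireLFunction_rat)
    (hKim13 : BDKim2013.cor315_signedCharValue_rankZero)
    (hGZK : rank_eq_analyticRank_of_analyticRank_le_one)
    (W A : WeierstrassCurve ℚ) [W.IsElliptic] [W.IsGloballyMinimal] [A.IsElliptic] [A.IsGloballyMinimal]
    [Fact (Nat.Prime 5)] (hW : W = ⟨0, 0, 0, -158470, 31707704⟩) (hA : A = ⟨0, 1, 0, -13, -21⟩)
    (hr : W.analyticRank = 0)
    (hPollack : ∀ {N : ℕ} [NeZero N] {f : CuspForm (Gamma0 N) 2},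
      pollack_exists_plusMinusPAdicLFunction (W := A) (f := f) (p := 5))
    (hPollackW : ∀ {N : ℕ} [NeZero N] {f : CuspForm (Gamma0 N) 2},
      pollack_exists_plusMinusPAdicLFunction (W := W) (f := f) (p := 5))
    [NeZero (W.conductorNorm ℤ)] {f₀ : CuspForm (Gamma0 (W.conductorNorm ℤ)) 2} (hf₀ : IsNewformOf W f₀)
    [NeZero (A.conductorNorm ℤ)] {f₀' : CuspForm (Gamma0 (A.conductorNorm ℤ)) 2} (hf₀' : IsNewformOf A f₀')
    {Θ Θ' : IwasawaAlgebra 5}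
    (hΘ : iwasawaToPowerSeries 5 Θ = ((mazurTateElement f₀ 5 1).map (algebraMap ℚ ℚ_[5]) : PowerSeries ℚ_[5]))
    (hΘ0 : Θ ≠ 0) (hμ : mu Θ = 0) (hlam : lam Θ = (cyclotomicOmegaPlus 5 1).natDegree + 2)
    (hΘ' : iwasawaToPowerSeries 5 Θ' = ((mazurTateElement f₀' 5 1).map (algebraMap ℚ ℚ_[5]) : PowerSeries ℚ_[5]))
    (hΘ'0 : Θ' ≠ 0) (hμ' : mu Θ' = 0) (hlam' : lam Θ' = (cyclotomicOmegaPlus 5 1).natDegree + 1) :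
    BSDp W 5 := by
  have hI : integralModelInt W = ⟨0, 0, 0, -158470, 31707704⟩ :=
    integralModelInt_eq_of_map_eq _ (by rw [hW]; ext <;> simp [WeierstrassCurve.map])
  have hp2 : (5 : ℕ) ≠ 2 := by decide
  have hX : ClassX7 W 5 :=
    classX7_of_intModel 5 hI (by decide) card_lam25_207616g1_5 (by norm_num) 2 Nat.prime_two (by decide) (by decide)
  have hap : W.frobeniusTrace 5 = 0 := by rw [frobeniusTrace_eq hI card_lam25_207616g1_5]; norm_num
  exact bsdp_of_kobayashiMainConjecture_of_analyticRank_eq_zero W 5 h12 hKim13 hPollackW hmod hmod' hGZK hp2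
    hX.1.1 hap (ClassX7.irr W 5 hp2 hX) hr
    (lam4_kobayashiMainConjecture_207616g1_5_dir h12 h41 h5 h3 h09 hKim hPR hmod hF W A hW hA hPollack hf₀ hf₀' (-1)
      hΘ0 hμ hΘ'0 hμ' (Or.inl ⟨rfl, hΘ, hlam, hΘ', hlam'⟩))

end Summit.BirchSwinnertonDyer.BirchSwinnertonDyer.Theorems.SmallImageCongruenceRoad

end
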